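import Summits.BirchSwinnertonDyer.BirchSwinnertonDyer.Theses.ErratumRoadFive
import Summits.BirchSwinnertonDyer.Rank1Residual.X11b.BDPRouteCyclotomicExceptional
import Summits.BirchSwinnertonDyer.Rank1Residual.X11b.RegMultCertificateJoin
import HarnessLib

/-!
# Route `ErratumRoadFive` (rung K2, `p ≥ 5`), crux `EulerHalfNotRamNoInertSetAtFive` (item 19715):
# the EXCEPTIONAL-ZERO ROAD AS AN EULER-HALF SUPPLIER at `p ≥ 5` — the crux from Kato's divisibility
# read through the `p`-adic leading terms, TAMAGAWA-BLIND and INERT-SET-BLIND, modulo one Schneider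
# row per pair and, ONLY on the pairs where `p` is the unique multiplicative prime, the exceptional
# display (cell `bsd-stepL`, seat `bsd-stepL-mult-p4` g2; `--supports stmt-BirchSwinnertonDyer-19715`)

Cell `bsd-stepL` (D-0131 (3) middle tier, seat `bsd-stepL-mult-p4`, lens «split-multiplicative
`r = 1` via the 𝓛-invariant `p`-adic Gross–Zagier»). THEOREMS ONLY, CONDITIONAL on the PUBLISHED
named facts in the binders and on the typed inputs named below; no definition, no new fact, no
`sorry`; nothing about any curve is asserted and no census word moves (TARGET T7).

## What

Crux 19715 asks for the Euler-system (UPPER) half `Typed.MissingUpperBoundAt W p` for `(E,p) ∈` X11b,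
`p ≥ 5`, `ρ̄_{E,p}` onto, NO (ram) prime, `p ∣ ∏ c_ℓ` and NO inert-set datum (the residue of the
Shimura ∕ Kolyvagin Euler-half road after the inert re-key). Census of record (kit j254667, its
docstring): 404 pairs = 334 with `p` the ONLY multiplicative prime (split at `p`, `p ∣ ord_p Δ`) + 70
with exactly three multiplicative primes `p, q₁, q₂`. The item's «why it might fail» names the
suppliers «Kato + Schneider … or an 𝓛-invariant road» for the 334 and «a mixed-field twist transport
not built» for the 70.

The cyclotomic reading of the upper half (Kato's divisibility `char X ∣ ϖ·L_p` in Wuthrich's surjective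
shape + the two leading terms at `T = 0`; tree engines
`X11b.missingUpperBoundAt_of_katoSurj_split_of_relativeLeadingTerm` ∕
`X11b.missingUpperBoundAt_of_katoSurj_nonsplit_of_schneider`, team x11b3) sees neither Tamagawa
numbers nor inert sets, and sorts the crux's pairs by a different key:
* `p` NON-SPLIT: Kato + SW Thm. 6.1 + Disegni 2020 Thm. 1 non-split clause + ONE non-split Schneider
  row — every class-level input PUBLISHED;
* `p` SPLIT with a SECOND multiplicative prime `m ≠ p` (in particular all 70 three-prime pairs):
  Kato + SW Thm. 6.1 split + Disegni 2020 Thm. 1 SPLIT clause (hypothesis (∗): `p ≥ 5` and another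
  multiplicative prime — NO ramification condition on `m`) + ONE split Schneider row — every
  class-level input PUBLISHED, no twist transport;
* `p` SPLIT and the ONLY multiplicative prime (the 334): Kato + SW + ONE split row + the exceptional
  display `ClassClosure.RelativeExceptionalLeadingTermAt W p` (in print only up to `ℚ^×`:
  Venerucci 2016 Thm. D via Mok ∕ Disegni Thm. 4 second bullet; exactness = BD07 Remark 6's missing
  case) — the ONE beyond-print input of this road, and it is needed: Kato + Schneider alone bound
  `#Ш[p^∞]` by the `p`-ADIC leading term `[T²]L_p`, not by `#Ш_an`.

## Results (namespace `…Theorems.ExceptionalZeroRoad`)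

§1 (pairs, any `p ≥ 5`, X11b ∩ `Surj`): `missingUpperBoundAt_of_surj_split_of_secondPrime_of_five_le`
(PUB mod the split row), `missingUpperBoundAt_of_surj_nonsplit_of_five_le` (PUB mod the non-split row),
`missingUpperBoundAt_of_surj_of_five_le_of_regulatorNonvanishing_of_relativeLeadingTerm` (bundled:
rung I1 at the pair + the display demanded ONLY when `p` is split and the unique multiplicative prime);
certificate currency `…_of_certSplit` ∕ `…_of_certNonsplit` (ONE REGMULT row).
§2 (the crux by name): **`erratumRoadFive_eulerHalfNotRamNoInertSetAtFive_of_relativeLeadingTerm_of_regulatorNonvanishing`**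
— `Theses.ErratumRoadFive.EulerHalfNotRamNoInertSetAtFive` from eight PUBLISHED named facts + rung I1 on
its locus + the display on its split-only sub-locus; the hypotheses `p ∣ ∏c` and «no inert-set datum»
of the crux are not used. `…_of_schneider` (the two Schneider halves as separate binders).

## Reading (numbers of record: the item's census; nothing moves)

70 ∕ 404 pairs of crux 19715 (three multiplicative primes) are reached modulo ONE REGMULT row each with
every class-level input PUBLISHED (no twist transport); the 334 split-only pairs modulo one row + the
exceptional display (beyond print: exactness of Venerucci's `ℓ₃` without BD07's auxiliary prime). The
class-wide split-only atom (55 089 pairs, TARGET §2) is this road's home residue. CONDITIONAL; closes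
nothing; the crux's Shimura-road reductions are untouched (a second supplier, by name).

References: [Wuthrich2014] Thm. 3 (p. 383), Cor. 19; [SteinWuthrich2013] Thm. 6.1, §4.2;
[Disegni2020] Thm. 1 (§1.2), hypothesis (∗), Thm. 4 (§3.2); [Venerucci2016] Thm. D;
[BertoliniDarmon2007] Remark 6; [MazurTateTeitelbaum1986Invent] §II.10; [SerreAbelianLadic1968] IV §3.4;
[Miller2011LMS] Def. 1.1. Cell files: HOME/mult-p4/EXZ-ROAD-MEMO-g0/g1/g2.md.
-/

set_option autoImplicit false

-- Theorems files of this problem live in `Summit.BirchSwinnertonDyer.BirchSwinnertonDyer.Theorems.*`.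
set_option linter.dupNamespace false

noncomputable section

open scoped Classical MatrixGroups ModularForm

open CongruenceSubgroup WeierstrassCurve Literature.NumberTheory.EllipticCurves
  Literature.NumberTheory.EllipticCurves.ModularForms
  Literature.NumberTheory.EllipticCurves.Rank1Residual
  Literature.NumberTheory.EllipticCurves.Rank1Residual.Typed
  Literature.NumberTheory.EllipticCurves.SteinWuthrich2013
  Literature.NumberTheory.EllipticCurves.Wuthrich2014

namespace Summit.BirchSwinnertonDyer.BirchSwinnertonDyer.Theorems.ExceptionalZeroRoad

open Summit.BirchSwinnertonDyer.Rank1Residual Summit.BirchSwinnertonDyer.Rank1Residual.X11b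

/-! ### §1 One pair at a time (`p ≥ 5`, X11b ∩ `Surj`) -/

section Pair

variable (W : WeierstrassCurve ℚ) [W.IsElliptic] [W.IsGloballyMinimal] (p : ℕ) [Fact p.Prime]

/-- **SPLIT X11b pair at `p ≥ 5` with `ρ̄_{E,p}` onto and a SECOND multiplicative prime: the Euler half
modulo one split Schneider row, every class-level input PUBLISHED.** Kato (`hKato`, Wuthrich Thm. 3 ∕
Cor. 19 shape; tower by Serre at `p ≥ 5`) + SW Thm. 6.1 split (`hJs`) + split height (`hHs`) + Disegni
2020 Thm. 1 SPLIT clause (`hDf`; hypothesis (∗) = `p ≥ 5` and another multiplicative prime `m`, no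
ramification condition) + GZK + parametrisation, and the split Schneider half `hSch`. No (ram), no
Tamagawa or inert-set hypothesis, no twist. CONDITIONAL on `hSch` (per pair one REGMULT row); nothing
booked. [cite: Disegni2020, Thm. 1 (§1.2), hypothesis (∗)] [cite: Wuthrich2014, Thm. 3 (p. 383), Cor. 19]
[cite: SteinWuthrich2013, Thm. 6.1, §4.2 (p. 16)] [cite: SerreAbelianLadic1968, Ch. IV §3.4] [cite: Miller2011LMS, Def. 1.1] -/
theorem missingUpperBoundAt_of_surj_split_of_secondPrime_of_five_le
    (hKato : kato_charIdeal_dvd_multiplicative_of_surjective) (hJs : thm61_splitMultiplicative)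
    (hHs : exists_isSplitMultCanonical) (hDf : Disegni2020.thm1_padicBSD_rankOne_multiplicative)
    (hGZK : rank_eq_analyticRank_of_analyticRank_le_one) (hpar : nonempty_modularParametrizationData)
    (hX : ClassX11b W p) (hp5 : 5 ≤ p) (hsurj : Surj W p)
    (hsplit : W.HasSplitMultiplicativeReductionAtPrime p)
    (hm : ∃ (m : ℕ) (_ : Fact m.Prime), m ≠ p ∧ W.HasMultiplicativeReductionAtPrime m)
    (hSch : ∀ (Dq : TateParameterData W p) (Dh : PAdicHeightData W p),
      IsSplitMultCanonical Dh Dq → SchneiderConjecture Dh) :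
    Typed.MissingUpperBoundAt W p :=
  missingUpperBoundAt_of_katoSurj_split_of_relativeLeadingTerm W p hKato hJs hHs hGZK hpar hX.2.1
    hX.2.2.1 hsplit hX.1
    (kato_charIdeal_dvd_multiplicative_of_surjective.surjective_pow_of_five_le W p hp5 hsurj)
    (ClassClosure.relativeExceptionalLeadingTermAt_of_disegni_of_five_le W p hDf hp5 hm) hSch

/-- **NON-SPLIT X11b pair at `p ≥ 5` with `ρ̄_{E,p}` onto: the Euler half modulo one non-split
Schneider row, every class-level input PUBLISHED** (Kato + SW Thm. 6.1 non-split + height + Disegni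
Thm. 1 non-split clause + GZK + parametrisation; tower by Serre). CONDITIONAL on `hSch`; nothing booked.
[cite: Disegni2020, Thm. 1 (§1.2) = Thm. 4 first bullet (§3.2)] [cite: Wuthrich2014, Thm. 3, Cor. 19]
[cite: SteinWuthrich2013, Thm. 6.1, §4.2 (p. 15)] [cite: SerreAbelianLadic1968, Ch. IV §3.4] [cite: Miller2011LMS, Def. 1.1] -/
theorem missingUpperBoundAt_of_surj_nonsplit_of_five_le
    (hKato : kato_charIdeal_dvd_multiplicative_of_surjective) (hJn : thm61_nonsplitMultiplicative)
    (hHn : exists_isMultCanonical) (hDf : Disegni2020.thm1_padicBSD_rankOne_multiplicative)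
    (hGZK : rank_eq_analyticRank_of_analyticRank_le_one) (hpar : nonempty_modularParametrizationData)
    (hX : ClassX11b W p) (hp5 : 5 ≤ p) (hsurj : Surj W p)
    (hns : ¬ W.HasSplitMultiplicativeReductionAtPrime p)
    (hSch : ∀ (q : ℚ_[p]) (Dh : PAdicHeightData W p), q ≠ 0 → ‖q‖ < 1 → tateJ q = (W.j : ℚ_[p]) →
      IsMultCanonical Dh q → SchneiderConjecture Dh) :
    Typed.MissingUpperBoundAt W p :=
  missingUpperBoundAt_of_katoSurj_nonsplit_of_schneider W p hKato hJn hHn hDf hGZK hpar hX.2.1 hX.2.2.1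
    hns hX.1 (kato_charIdeal_dvd_multiplicative_of_surjective.surjective_pow_of_five_le W p hp5 hsurj)
    hSch

/-- **Any X11b pair at `p ≥ 5` with `ρ̄_{E,p}` onto**: rung I1 at the pair
(`ClassClosure.RegulatorNonvanishingAt W p`) and — ONLY if `p` is split AND the unique multiplicative
prime of `E` — the exceptional display `ClassClosure.RelativeExceptionalLeadingTermAt W p` ⟹ the Euler
half. With a second multiplicative prime the display is Disegni's Thm. 1 (PUBLISHED). CONDITIONAL;
nothing booked. [cite: Disegni2020, Thm. 1 (§1.2), hypothesis (∗), Thm. 4 (§3.2)]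
[cite: Wuthrich2014, Thm. 3, Cor. 19] [cite: SteinWuthrich2013, Thm. 6.1, §4.2] [cite: Miller2011LMS, Def. 1.1] -/
theorem missingUpperBoundAt_of_surj_of_five_le_of_regulatorNonvanishing_of_relativeLeadingTerm
    (hKato : kato_charIdeal_dvd_multiplicative_of_surjective) (hJs : thm61_splitMultiplicative)
    (hJn : thm61_nonsplitMultiplicative) (hHs : exists_isSplitMultCanonical)
    (hHn : exists_isMultCanonical) (hDf : Disegni2020.thm1_padicBSD_rankOne_multiplicative)
    (hGZK : rank_eq_analyticRank_of_analyticRank_le_one) (hpar : nonempty_modularParametrizationData)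
    (hX : ClassX11b W p) (hp5 : 5 ≤ p) (hsurj : Surj W p)
    (hReg : ClassClosure.RegulatorNonvanishingAt W p)
    (hC : W.HasSplitMultiplicativeReductionAtPrime p →
      (¬ ∃ (m : ℕ) (_ : Fact m.Prime), m ≠ p ∧ W.HasMultiplicativeReductionAtPrime m) →
        ClassClosure.RelativeExceptionalLeadingTermAt W p) :
    Typed.MissingUpperBoundAt W p := by
  by_cases hsplit : W.HasSplitMultiplicativeReductionAtPrime p
  · by_cases hm : ∃ (m : ℕ) (_ : Fact m.Prime), m ≠ p ∧ W.HasMultiplicativeReductionAtPrime m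
    · exact missingUpperBoundAt_of_surj_split_of_secondPrime_of_five_le W p hKato hJs hHs hDf hGZK hpar
        hX hp5 hsurj hsplit hm hReg.2
    · exact missingUpperBoundAt_of_katoSurj_split_of_relativeLeadingTerm W p hKato hJs hHs hGZK hpar hX.2.1
        hX.2.2.1 hsplit hX.1
        (kato_charIdeal_dvd_multiplicative_of_surjective.surjective_pow_of_five_le W p hp5 hsurj)
        (hC hsplit hm) hReg.2
  · exact missingUpperBoundAt_of_surj_nonsplit_of_five_le W p hKato hJn hHn hDf hGZK hpar hX hp5 hsurj
      hsplit hReg.1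

/-- **Certificate currency, SPLIT with a second multiplicative prime** (the 70 three-prime pairs of the
item's census, when split at `p`): ONE row `RegMult.CertSplit W p P m` ⟹ the Euler half, every
class-level input PUBLISHED. Rows are instrumentation (EVIDENCE); nothing booked.
[cite: SteinWuthrich2013, §4.2 (p. 16)] [cite: Disegni2020, Thm. 1 (§1.2), hypothesis (∗)] [cite: Wuthrich2014, Thm. 3, Cor. 19] -/
theorem missingUpperBoundAt_of_surj_split_of_secondPrime_of_five_le_of_certSplit
    (hKato : kato_charIdeal_dvd_multiplicative_of_surjective) (hJs : thm61_splitMultiplicative)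
    (hHs : exists_isSplitMultCanonical) (hDf : Disegni2020.thm1_padicBSD_rankOne_multiplicative)
    (hGZK : rank_eq_analyticRank_of_analyticRank_le_one) (hpar : nonempty_modularParametrizationData)
    (hX : ClassX11b W p) (hp5 : 5 ≤ p) (hsurj : Surj W p)
    (hsplit : W.HasSplitMultiplicativeReductionAtPrime p)
    (hm : ∃ (m : ℕ) (_ : Fact m.Prime), m ≠ p ∧ W.HasMultiplicativeReductionAtPrime m)
    {P : W.toAffine.Point} {n : ℕ} (hc : RegMult.CertSplit W p P n) :
    Typed.MissingUpperBoundAt W p :=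
  missingUpperBoundAt_of_surj_split_of_secondPrime_of_five_le W p hKato hJs hHs hDf hGZK hpar hX hp5 hsurj
    hsplit hm (RegMult.schneiderHalf_split_of_cert (mordellWeilRank_eq_one_of_analyticRank hGZK hX.1) hc)

/-- **Certificate currency, NON-SPLIT**: ONE row `RegMult.CertNonsplit W p P m` ⟹ the Euler half, every
class-level input PUBLISHED. Rows are instrumentation; nothing booked.
[cite: SteinWuthrich2013, §4.2 (p. 15)] [cite: Disegni2020, Thm. 1 (§1.2)] [cite: Wuthrich2014, Thm. 3, Cor. 19] -/
theorem missingUpperBoundAt_of_surj_nonsplit_of_five_le_of_certNonsplit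
    (hKato : kato_charIdeal_dvd_multiplicative_of_surjective) (hJn : thm61_nonsplitMultiplicative)
    (hHn : exists_isMultCanonical) (hDf : Disegni2020.thm1_padicBSD_rankOne_multiplicative)
    (hGZK : rank_eq_analyticRank_of_analyticRank_le_one) (hpar : nonempty_modularParametrizationData)
    (hX : ClassX11b W p) (hp5 : 5 ≤ p) (hsurj : Surj W p)
    (hns : ¬ W.HasSplitMultiplicativeReductionAtPrime p)
    {P : W.toAffine.Point} {n : ℕ} (hc : RegMult.CertNonsplit W p P n) :
    Typed.MissingUpperBoundAt W p :=
  missingUpperBoundAt_of_surj_nonsplit_of_five_le W p hKato hJn hHn hDf hGZK hpar hX hp5 hsurj hns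
    (RegMult.schneiderHalf_nonsplit_of_cert (mordellWeilRank_eq_one_of_analyticRank hGZK hX.1) hc)

end Pair

/-! ### §2 The crux `EulerHalfNotRamNoInertSetAtFive` by name -/

section Crux

/-- **Crux 19715 `EulerHalfNotRamNoInertSetAtFive` of route `ErratumRoadFive`, BY NAME, from the
exceptional-zero road.** Inputs: eight PUBLISHED named facts (`hKato`, `hJs`, `hJn`, `hHs`, `hHn`,
`hDf`, `hGZK`, `hpar`), the two Schneider halves on the crux's locus (`hSchS` on its split pairs, `hSchN`
on its non-split pairs — rung I1; per pair ONE REGMULT row), and the exceptional display `hC` demanded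
ONLY on the pairs where `p` is split AND the unique multiplicative prime (the 334 of the item's census;
beyond print: exactness of Venerucci's constant). The crux's hypotheses `p ∣ ∏c` and «no inert-set
datum» are NOT used (Tamagawa- and inert-set-blind). CONDITIONAL on `hC`, `hSchS`, `hSchN`; closes
nothing; the Shimura-road reductions of the item are untouched (a second supplier).
[cite: Disegni2020, Thm. 1 (§1.2), hypothesis (∗), Thm. 4 (§3.2)] [cite: Wuthrich2014, Thm. 3 (p. 383), Cor. 19]
[cite: SteinWuthrich2013, Thm. 6.1, §4.2] [cite: MazurTateTeitelbaum1986Invent, §II.10] [cite: Miller2011LMS, Def. 1.1] -/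
theorem erratumRoadFive_eulerHalfNotRamNoInertSetAtFive_of_relativeLeadingTerm_of_schneider
    (hKato : kato_charIdeal_dvd_multiplicative_of_surjective) (hJs : thm61_splitMultiplicative)
    (hJn : thm61_nonsplitMultiplicative) (hHs : exists_isSplitMultCanonical)
    (hHn : exists_isMultCanonical) (hDf : Disegni2020.thm1_padicBSD_rankOne_multiplicative)
    (hGZK : rank_eq_analyticRank_of_analyticRank_le_one) (hpar : nonempty_modularParametrizationData)
    (hC : ∀ (W : WeierstrassCurve ℚ) [W.IsElliptic] [W.IsGloballyMinimal] (p : ℕ) [Fact p.Prime],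
      ClassX11b W p → 5 ≤ p → Surj W p → ¬ Ram W p → W.HasSplitMultiplicativeReductionAtPrime p →
        (¬ ∃ (m : ℕ) (_ : Fact m.Prime), m ≠ p ∧ W.HasMultiplicativeReductionAtPrime m) →
          ClassClosure.RelativeExceptionalLeadingTermAt W p)
    (hSchS : ∀ (W : WeierstrassCurve ℚ) [W.IsElliptic] [W.IsGloballyMinimal] (p : ℕ) [Fact p.Prime],
      ClassX11b W p → 5 ≤ p → Surj W p → ¬ Ram W p → W.HasSplitMultiplicativeReductionAtPrime p →
        ∀ (Dq : TateParameterData W p) (Dh : PAdicHeightData W p),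
          IsSplitMultCanonical Dh Dq → SchneiderConjecture Dh)
    (hSchN : ∀ (W : WeierstrassCurve ℚ) [W.IsElliptic] [W.IsGloballyMinimal] (p : ℕ) [Fact p.Prime],
      ClassX11b W p → 5 ≤ p → Surj W p → ¬ Ram W p → ¬ W.HasSplitMultiplicativeReductionAtPrime p →
        ∀ (q : ℚ_[p]) (Dh : PAdicHeightData W p), q ≠ 0 → ‖q‖ < 1 → tateJ q = (W.j : ℚ_[p]) →
          IsMultCanonical Dh q → SchneiderConjecture Dh) :
    Summit.BirchSwinnertonDyer.BirchSwinnertonDyer.Theses.ErratumRoadFive.EulerHalfNotRamNoInertSetAtFive := by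
  intro W _ _ p _ hX hp5 hsurj hnr _ _
  by_cases hsplit : W.HasSplitMultiplicativeReductionAtPrime p
  · by_cases hm : ∃ (m : ℕ) (_ : Fact m.Prime), m ≠ p ∧ W.HasMultiplicativeReductionAtPrime m
    · exact missingUpperBoundAt_of_surj_split_of_secondPrime_of_five_le W p hKato hJs hHs hDf hGZK hpar
        hX hp5 hsurj hsplit hm (hSchS W p hX hp5 hsurj hnr hsplit)
    · exact missingUpperBoundAt_of_katoSurj_split_of_relativeLeadingTerm W p hKato hJs hHs hGZK hpar hX.2.1
        hX.2.2.1 hsplit hX.1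
        (kato_charIdeal_dvd_multiplicative_of_surjective.surjective_pow_of_five_le W p hp5 hsurj)
        (hC W p hX hp5 hsurj hnr hsplit hm) (hSchS W p hX hp5 hsurj hnr hsplit)
  · exact missingUpperBoundAt_of_surj_nonsplit_of_five_le W p hKato hJn hHn hDf hGZK hpar hX hp5 hsurj
      hsplit (hSchN W p hX hp5 hsurj hnr hsplit)

/-- **Bundled form**: the display on the split-only sub-locus + rung I1
(`ClassClosure.RegulatorNonvanishingAt W p`) on the crux's locus ⟹ crux 19715. CONDITIONAL; nothing
booked. [cite: Disegni2020, Thm. 1 (§1.2), Thm. 4 (§3.2)] [cite: Wuthrich2014, Thm. 3, Cor. 19]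
[cite: SteinWuthrich2013, Thm. 6.1, §4.2] -/
theorem erratumRoadFive_eulerHalfNotRamNoInertSetAtFive_of_relativeLeadingTerm_of_regulatorNonvanishing
    (hKato : kato_charIdeal_dvd_multiplicative_of_surjective) (hJs : thm61_splitMultiplicative)
    (hJn : thm61_nonsplitMultiplicative) (hHs : exists_isSplitMultCanonical)
    (hHn : exists_isMultCanonical) (hDf : Disegni2020.thm1_padicBSD_rankOne_multiplicative)
    (hGZK : rank_eq_analyticRank_of_analyticRank_le_one) (hpar : nonempty_modularParametrizationData)
    (hC : ∀ (W : WeierstrassCurve ℚ) [W.IsElliptic] [W.IsGloballyMinimal] (p : ℕ) [Fact p.Prime],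
      ClassX11b W p → 5 ≤ p → Surj W p → ¬ Ram W p → W.HasSplitMultiplicativeReductionAtPrime p →
        (¬ ∃ (m : ℕ) (_ : Fact m.Prime), m ≠ p ∧ W.HasMultiplicativeReductionAtPrime m) →
          ClassClosure.RelativeExceptionalLeadingTermAt W p)
    (hReg : ∀ (W : WeierstrassCurve ℚ) [W.IsElliptic] [W.IsGloballyMinimal] (p : ℕ) [Fact p.Prime],
      ClassX11b W p → 5 ≤ p → Surj W p → ¬ Ram W p → ClassClosure.RegulatorNonvanishingAt W p) :
    Summit.BirchSwinnertonDyer.BirchSwinnertonDyer.Theses.ErratumRoadFive.EulerHalfNotRamNoInertSetAtFive :=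
  erratumRoadFive_eulerHalfNotRamNoInertSetAtFive_of_relativeLeadingTerm_of_schneider hKato hJs hJn hHs
    hHn hDf hGZK hpar hC (fun W _ _ p _ hX hp5 hsurj hnr _ ↦ (hReg W p hX hp5 hsurj hnr).2)
    (fun W _ _ p _ hX hp5 hsurj hnr _ ↦ (hReg W p hX hp5 hsurj hnr).1)

end Crux

/-! ### §3 (appended, g2) The REGISTERED STUBS of crux 19715's line `Lines/birth.lean` (planner g26:
`stub_res_pOnlyMultAtFive`, `stub_res_otherMultAtFive`, `stub_rung_res_8085y1`), each VERBATIM, modulo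
rung I1 at the pair (and, for the split-only stub, the exceptional display) -/

section Stubs

/-- **`stub_res_otherMultAtFive` (the 70 three-prime «parity pairs», census R1b) modulo rung I1 ONLY.**
The registered stub text VERBATIM as conclusion, from the eight PUBLISHED named facts and ONE binder:
`ClassClosure.RegulatorNonvanishingAt W p` on the stub's own locus (per pair ONE REGMULT row). The
second multiplicative prime `ℓ` of the stub IS Disegni Thm. 1's hypothesis (∗) when `p` is split; when
`p` is non-split the first bullet applies. The stub's `p ∣ ∏c` and «no inert-set datum» binders are
idle; no twist transport, no level raising. CONDITIONAL on `hReg`; nothing booked.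
[cite: Disegni2020, Thm. 1 (§1.2), hypothesis (∗), Thm. 4 (§3.2)] [cite: Wuthrich2014, Thm. 3, Cor. 19]
[cite: SteinWuthrich2013, Thm. 6.1, §4.2] [cite: Miller2011LMS, Def. 1.1] -/
theorem stub_res_otherMultAtFive_of_regulatorNonvanishing
    (hKato : kato_charIdeal_dvd_multiplicative_of_surjective) (hJs : thm61_splitMultiplicative)
    (hJn : thm61_nonsplitMultiplicative) (hHs : exists_isSplitMultCanonical)
    (hHn : exists_isMultCanonical) (hDf : Disegni2020.thm1_padicBSD_rankOne_multiplicative)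
    (hGZK : rank_eq_analyticRank_of_analyticRank_le_one) (hpar : nonempty_modularParametrizationData)
    (hReg : ∀ (W : WeierstrassCurve ℚ) [W.IsElliptic] [W.IsGloballyMinimal] (p : ℕ) [Fact p.Prime],
      ClassX11b W p → 5 ≤ p → Surj W p → ¬ Ram W p →
        (∃ ℓ : ℕ, ∃ _ : Fact ℓ.Prime, ℓ ≠ p ∧ W.HasMultiplicativeReductionAtPrime ℓ) →
          ClassClosure.RegulatorNonvanishingAt W p) :
    ∀ (W : WeierstrassCurve ℚ) [W.IsElliptic] [W.IsGloballyMinimal] (p : ℕ) [Fact p.Prime],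
      ClassX11b W p → 5 ≤ p → Surj W p → ¬ Ram W p → p ∣ W.tamagawaProduct →
        (∃ ℓ : ℕ, ∃ _ : Fact ℓ.Prime, ℓ ≠ p ∧ W.HasMultiplicativeReductionAtPrime ℓ) →
          ¬ (∃ S : Finset ℕ, (∀ ℓ ∈ S, ∃ _ : Fact ℓ.Prime, Mult W ℓ) ∧ Even S.card ∧ p ∈ S ∧
              (∀ (ℓ : ℕ) [Fact ℓ.Prime], ℓ ∉ S → W.HasSplitMultiplicativeReductionAtPrime ℓ →
                ¬ p ∣ padicValInt ℓ W.minimalDiscriminantInt) ∧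
              (¬ p ∣ padicValInt p W.minimalDiscriminantInt ∨
                ∃ R ⊆ S, S.card = 2 * R.card ∧ ∀ q ∈ R, q ≠ 2 ∧ ¬ p ∣ q - 1)) →
            Typed.MissingUpperBoundAt W p :=
  fun W _ _ p _ hX hp5 hsurj hnr _ hm _ ↦
    missingUpperBoundAt_of_surj_of_five_le_of_regulatorNonvanishing_of_relativeLeadingTerm W p hKato hJs
      hJn hHs hHn hDf hGZK hpar hX hp5 hsurj (hReg W p hX hp5 hsurj hnr hm) (fun _ hno ↦ (hno hm).elim)

/-- **`stub_res_pOnlyMultAtFive` (the 334 split-only pairs, census R1a) modulo rung I1 AND the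
exceptional display.** The registered stub text VERBATIM as conclusion, from the eight PUBLISHED named
facts, `ClassClosure.RegulatorNonvanishingAt W p` on the stub's locus and — IF `p` is split (the
census says: always, `p ∣ c_p`) — the display `ClassClosure.RelativeExceptionalLeadingTermAt W p` on the
stub's locus (beyond print: Disegni Thm. 4's second bullet is «up to a nonzero rational number» without a
second multiplicative prime). CONDITIONAL on both binders; nothing booked.
[cite: Disegni2020, Thm. 4 (§3.2)] [cite: Venerucci2016, Thm. D] [cite: BertoliniDarmon2007, Remark 6]
[cite: Wuthrich2014, Thm. 3, Cor. 19] [cite: SteinWuthrich2013, Thm. 6.1, §4.2] [cite: Miller2011LMS, Def. 1.1] -/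
theorem stub_res_pOnlyMultAtFive_of_relativeLeadingTerm_of_regulatorNonvanishing
    (hKato : kato_charIdeal_dvd_multiplicative_of_surjective) (hJs : thm61_splitMultiplicative)
    (hJn : thm61_nonsplitMultiplicative) (hHs : exists_isSplitMultCanonical)
    (hHn : exists_isMultCanonical) (hDf : Disegni2020.thm1_padicBSD_rankOne_multiplicative)
    (hGZK : rank_eq_analyticRank_of_analyticRank_le_one) (hpar : nonempty_modularParametrizationData)
    (hC : ∀ (W : WeierstrassCurve ℚ) [W.IsElliptic] [W.IsGloballyMinimal] (p : ℕ) [Fact p.Prime],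
      ClassX11b W p → 5 ≤ p → Surj W p → ¬ Ram W p →
        (∀ (ℓ : ℕ) [Fact ℓ.Prime], W.HasMultiplicativeReductionAtPrime ℓ → ℓ = p) →
          W.HasSplitMultiplicativeReductionAtPrime p → ClassClosure.RelativeExceptionalLeadingTermAt W p)
    (hReg : ∀ (W : WeierstrassCurve ℚ) [W.IsElliptic] [W.IsGloballyMinimal] (p : ℕ) [Fact p.Prime],
      ClassX11b W p → 5 ≤ p → Surj W p → ¬ Ram W p →
        (∀ (ℓ : ℕ) [Fact ℓ.Prime], W.HasMultiplicativeReductionAtPrime ℓ → ℓ = p) →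
          ClassClosure.RegulatorNonvanishingAt W p) :
    ∀ (W : WeierstrassCurve ℚ) [W.IsElliptic] [W.IsGloballyMinimal] (p : ℕ) [Fact p.Prime],
      ClassX11b W p → 5 ≤ p → Surj W p → ¬ Ram W p → p ∣ W.tamagawaProduct →
        (∀ (ℓ : ℕ) [Fact ℓ.Prime], W.HasMultiplicativeReductionAtPrime ℓ → ℓ = p) →
          Typed.MissingUpperBoundAt W p :=
  fun W _ _ p _ hX hp5 hsurj hnr _ honly ↦
    missingUpperBoundAt_of_surj_of_five_le_of_regulatorNonvanishing_of_relativeLeadingTerm W p hKato hJs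
      hJn hHs hHn hDf hGZK hpar hX hp5 hsurj (hReg W p hX hp5 hsurj hnr honly)
      (fun hsplit _ ↦ hC W p hX hp5 hsurj hnr honly hsplit)

/-- **`stub_rung_res_8085y1` — the line's BC5 rung (8085y1 = `[0,1,1,−6435,−644416]` at `p = 5`;
multiplicative primes 3, 5, 11, so a SECOND multiplicative prime is among the rung's own hypotheses)
modulo rung I1 at the pair ONLY**: the registered rung text VERBATIM as conclusion, from the eight
PUBLISHED named facts and `ClassClosure.RegulatorNonvanishingAt E 5` (ONE REGMULT row for (8085y1, 5);
the split half suffices if, as the census records, `5` is split). No twist transport, no Shimura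
curve, no level raising. CONDITIONAL on `hReg`; nothing booked. [cite: Disegni2020, Thm. 1 (§1.2), hypothesis (∗)]
[cite: Wuthrich2014, Thm. 3, Cor. 19] [cite: SteinWuthrich2013, Thm. 6.1, §4.2]
[cite: Cremona1997, Table 1 (curve 8085y1)] [cite: Miller2011LMS, Def. 1.1] -/
theorem stub_rung_res_8085y1_of_regulatorNonvanishing
    (hKato : kato_charIdeal_dvd_multiplicative_of_surjective) (hJs : thm61_splitMultiplicative)
    (hJn : thm61_nonsplitMultiplicative) (hHs : exists_isSplitMultCanonical)
    (hHn : exists_isMultCanonical) (hDf : Disegni2020.thm1_padicBSD_rankOne_multiplicative)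
    (hGZK : rank_eq_analyticRank_of_analyticRank_le_one) (hpar : nonempty_modularParametrizationData)
    [((⟨0, 1, 1, -6435, -644416⟩ : WeierstrassCurve ℤ).baseChange ℚ).IsElliptic] [((⟨0, 1, 1, -6435, -644416⟩ : WeierstrassCurve ℤ).baseChange ℚ).IsGloballyMinimal] [Fact (Nat.Prime 5)]
    (hReg : ClassClosure.RegulatorNonvanishingAt ((⟨0, 1, 1, -6435, -644416⟩ : WeierstrassCurve ℤ).baseChange ℚ) 5) :
    ClassX11b ((⟨0, 1, 1, -6435, -644416⟩ : WeierstrassCurve ℤ).baseChange ℚ) 5 → 5 ≤ 5 → Surj ((⟨0, 1, 1, -6435, -644416⟩ : WeierstrassCurve ℤ).baseChange ℚ) 5 → ¬ Ram ((⟨0, 1, 1, -6435, -644416⟩ : WeierstrassCurve ℤ).baseChange ℚ) 5 → 5 ∣ ((⟨0, 1, 1, -6435, -644416⟩ : WeierstrassCurve ℤ).baseChange ℚ).tamagawaProduct →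
      (∃ ℓ : ℕ, ∃ _ : Fact ℓ.Prime, ℓ ≠ 5 ∧ ((⟨0, 1, 1, -6435, -644416⟩ : WeierstrassCurve ℤ).baseChange ℚ).HasMultiplicativeReductionAtPrime ℓ) →
        ¬ (∃ S : Finset ℕ, (∀ ℓ ∈ S, ∃ _ : Fact ℓ.Prime, Mult ((⟨0, 1, 1, -6435, -644416⟩ : WeierstrassCurve ℤ).baseChange ℚ) ℓ) ∧ Even S.card ∧ 5 ∈ S ∧
            (∀ (ℓ : ℕ) [Fact ℓ.Prime], ℓ ∉ S → ((⟨0, 1, 1, -6435, -644416⟩ : WeierstrassCurve ℤ).baseChange ℚ).HasSplitMultiplicativeReductionAtPrime ℓ →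
              ¬ 5 ∣ padicValInt ℓ ((⟨0, 1, 1, -6435, -644416⟩ : WeierstrassCurve ℤ).baseChange ℚ).minimalDiscriminantInt) ∧
            (¬ 5 ∣ padicValInt 5 ((⟨0, 1, 1, -6435, -644416⟩ : WeierstrassCurve ℤ).baseChange ℚ).minimalDiscriminantInt ∨
              ∃ R ⊆ S, S.card = 2 * R.card ∧ ∀ q ∈ R, q ≠ 2 ∧ ¬ 5 ∣ q - 1)) →
          Typed.MissingUpperBoundAt ((⟨0, 1, 1, -6435, -644416⟩ : WeierstrassCurve ℤ).baseChange ℚ) 5 :=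
  fun hX hp5 hsurj _ _ hm _ ↦
    missingUpperBoundAt_of_surj_of_five_le_of_regulatorNonvanishing_of_relativeLeadingTerm ((⟨0, 1, 1, -6435, -644416⟩ : WeierstrassCurve ℤ).baseChange ℚ) 5 hKato
      hJs hJn hHs hHn hDf hGZK hpar hX hp5 hsurj hReg (fun _ hno ↦ (hno hm).elim)

/-- **The same rung in certificate currency, granted that `5` is SPLIT for 8085y1 (census: `ord₅Δ = 1`,
all three multiplicative primes split)**: ONE split REGMULT row `RegMult.CertSplit E 5 P m` ⟹ the rung,
every class-level input PUBLISHED. The reduction type is taken as a hypothesis (`hsplit`), not computed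
here. Rows are instrumentation (EVIDENCE); nothing booked. [cite: Disegni2020, Thm. 1 (§1.2), hypothesis (∗)]
[cite: SteinWuthrich2013, §4.2 (p. 16)] [cite: Cremona1997, Table 1 (curve 8085y1)] -/
theorem stub_rung_res_8085y1_of_split_of_certSplit
    (hKato : kato_charIdeal_dvd_multiplicative_of_surjective) (hJs : thm61_splitMultiplicative)
    (hHs : exists_isSplitMultCanonical) (hDf : Disegni2020.thm1_padicBSD_rankOne_multiplicative)
    (hGZK : rank_eq_analyticRank_of_analyticRank_le_one) (hpar : nonempty_modularParametrizationData)
    [((⟨0, 1, 1, -6435, -644416⟩ : WeierstrassCurve ℤ).baseChange ℚ).IsElliptic] [((⟨0, 1, 1, -6435, -644416⟩ : WeierstrassCurve ℤ).baseChange ℚ).IsGloballyMinimal] [Fact (Nat.Prime 5)]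
    (hsplit : ((⟨0, 1, 1, -6435, -644416⟩ : WeierstrassCurve ℤ).baseChange ℚ).HasSplitMultiplicativeReductionAtPrime 5)
    {P : ((⟨0, 1, 1, -6435, -644416⟩ : WeierstrassCurve ℤ).baseChange ℚ).toAffine.Point} {m : ℕ} (hc : RegMult.CertSplit ((⟨0, 1, 1, -6435, -644416⟩ : WeierstrassCurve ℤ).baseChange ℚ) 5 P m) :
    ClassX11b ((⟨0, 1, 1, -6435, -644416⟩ : WeierstrassCurve ℤ).baseChange ℚ) 5 → 5 ≤ 5 → Surj ((⟨0, 1, 1, -6435, -644416⟩ : WeierstrassCurve ℤ).baseChange ℚ) 5 → ¬ Ram ((⟨0, 1, 1, -6435, -644416⟩ : WeierstrassCurve ℤ).baseChange ℚ) 5 → 5 ∣ ((⟨0, 1, 1, -6435, -644416⟩ : WeierstrassCurve ℤ).baseChange ℚ).tamagawaProduct →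
      (∃ ℓ : ℕ, ∃ _ : Fact ℓ.Prime, ℓ ≠ 5 ∧ ((⟨0, 1, 1, -6435, -644416⟩ : WeierstrassCurve ℤ).baseChange ℚ).HasMultiplicativeReductionAtPrime ℓ) →
        ¬ (∃ S : Finset ℕ, (∀ ℓ ∈ S, ∃ _ : Fact ℓ.Prime, Mult ((⟨0, 1, 1, -6435, -644416⟩ : WeierstrassCurve ℤ).baseChange ℚ) ℓ) ∧ Even S.card ∧ 5 ∈ S ∧
            (∀ (ℓ : ℕ) [Fact ℓ.Prime], ℓ ∉ S → ((⟨0, 1, 1, -6435, -644416⟩ : WeierstrassCurve ℤ).baseChange ℚ).HasSplitMultiplicativeReductionAtPrime ℓ →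
              ¬ 5 ∣ padicValInt ℓ ((⟨0, 1, 1, -6435, -644416⟩ : WeierstrassCurve ℤ).baseChange ℚ).minimalDiscriminantInt) ∧
            (¬ 5 ∣ padicValInt 5 ((⟨0, 1, 1, -6435, -644416⟩ : WeierstrassCurve ℤ).baseChange ℚ).minimalDiscriminantInt ∨
              ∃ R ⊆ S, S.card = 2 * R.card ∧ ∀ q ∈ R, q ≠ 2 ∧ ¬ 5 ∣ q - 1)) →
          Typed.MissingUpperBoundAt ((⟨0, 1, 1, -6435, -644416⟩ : WeierstrassCurve ℤ).baseChange ℚ) 5 :=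
  fun hX hp5 hsurj _ _ hm _ ↦
    missingUpperBoundAt_of_surj_split_of_secondPrime_of_five_le_of_certSplit ((⟨0, 1, 1, -6435, -644416⟩ : WeierstrassCurve ℤ).baseChange ℚ) 5 hKato hJs hHs hDf
      hGZK hpar hX hp5 hsurj hsplit hm hc

end Stubs

end Summit.BirchSwinnertonDyer.BirchSwinnertonDyer.Theorems.ExceptionalZeroRoad

end
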